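import Mathlib
import Literature.Analysis.Calculus.RadiiPolynomialTwoRadii
import HarnessLib

/-!
# `PicardRadiiRungThree.RadiiGlueR` (item stmt-NavierStokesRegularity-23947) — generic core: Picard
  paths are differentiable, and Newton–Kantorovich zeros depend Lipschitz-continuously on a constant
  shift of the map

Route `PicardRadiiRungThree` (rung TL-M3 of the Tao ladder; MODEL lattice ODEs only). Two generic
functional-analytic facts used by the extraction glue `RadiiGlueR` (Newton–Kantorovich certificate in
path space ⇒ exact-flow window certificate):

* `picardPath_hasDerivWithinAt` — if a continuous path `p : C([0,1], E)` (`E` real Banach) satisfies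
  the integral equation `p(t) = z + T • ∫₀ᵗ f(p̃(u)) du` with `f` continuous and `p̃ = IccExtend p`, then
  `p̃` has derivative `T • f(p̃(t))` within `[0,1]` at every `t ∈ [0,1]`, and `p̃(0) = z` (fundamental
  theorem of calculus for the Bochner integral);
* `norm_sub_le_of_zero_of_zero_add_const` — if `g = I − A F` is a `Z`-contraction on a closed ball
  (`‖I − A ∘ F'(x)‖ ≤ Z < 1`, mean value inequality) and `x₁, x₂` in the ball are zeros of `F` and of
  the shifted map `F + v`, then `‖x₁ − x₂‖ ≤ ‖A v‖ / (1 − Z)`: the zero of a Newton–Kantorovich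
  certificate moves Lipschitz-continuously under constant shifts of the map (the restart/tube clause of
  the window certificate).

HONEST FRAMING: elementary analysis; nothing here is a statement about the Navier–Stokes equations; NS
regularity is NOT proved by anything in this file.
-/

noncomputable section

-- the sub-problem namespace repeats the summit name by design (D-0017)
set_option linter.dupNamespace false

namespace Summit.NavierStokesRegularity.NavierStokesRegularity.Theorems

open Set Metric MeasureTheory intervalIntegral Literature.Analysis.Calculus

namespace RadiiGlueR

/-! ### Picard paths are differentiable -/

section Picard

variable {E : Type*} [NormedAddCommGroup E] [NormedSpace ℝ E] [CompleteSpace E]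

/-- **Picard paths are differentiable.** Let `f : E → E` be continuous, `z ∈ E`, `T ∈ ℝ`, and let the
continuous path `p : C([0,1], E)` satisfy `p(t) = z + T • ∫₀ᵗ f(p̃(u)) du` for all `t ∈ [0,1]`, where
`p̃ = IccExtend p` is the constant extension. Then `p̃` has derivative `T • f(p̃(t))` within `[0,1]` at
every `t ∈ [0,1]`. [folklore] -/
theorem picardPath_hasDerivWithinAt {f : E → E} (hf : Continuous f) {z : E} {T : ℝ}
    {p : C(↥(Icc (0 : ℝ) 1), E)}
    (hp : ∀ t : ↥(Icc (0 : ℝ) 1), p t = z + T • ∫ u in (0 : ℝ)..(t : ℝ), f (IccExtend zero_le_one p u)) :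
    ∀ t ∈ Icc (0 : ℝ) 1, HasDerivWithinAt (IccExtend zero_le_one p)
      (T • f (IccExtend zero_le_one p t)) (Icc 0 1) t := by
  intro t ht
  set pt : ℝ → E := IccExtend zero_le_one p with hpt
  have hptc : Continuous pt := (p.continuous).Icc_extend'
  have hgc : Continuous fun u => f (pt u) := hf.comp hptc
  -- the integral curve on ℝ
  set P : ℝ → E := fun s => z + T • ∫ u in (0 : ℝ)..s, f (pt u) with hP
  have hPderiv : HasDerivAt P (T • f (pt t)) t := by
    have h1 := (hgc.integral_hasStrictDerivAt 0 t).hasDerivAt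
    have h2 := h1.const_smul T
    simpa [hP] using h2.const_add z
  -- `pt` agrees with `P` on [0, 1]
  have heq : ∀ s ∈ Icc (0 : ℝ) 1, pt s = P s := by
    intro s hs
    rw [hpt, IccExtend_of_mem zero_le_one p hs]
    exact hp ⟨s, hs⟩
  exact (hPderiv.hasDerivWithinAt.congr (fun s hs => heq s hs) (heq t ht))

omit [CompleteSpace E] in
/-- The Picard path starts at `z`: `p̃(0) = z`. [folklore] -/
theorem picardPath_zero {f : E → E} {z : E} {T : ℝ} {p : C(↥(Icc (0 : ℝ) 1), E)}
    (hp : ∀ t : ↥(Icc (0 : ℝ) 1), p t = z + T • ∫ u in (0 : ℝ)..(t : ℝ), f (IccExtend zero_le_one p u)) :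
    IccExtend zero_le_one p 0 = z := by
  have h0 : (0 : ℝ) ∈ Icc (0 : ℝ) 1 := ⟨le_rfl, zero_le_one⟩
  rw [IccExtend_of_mem zero_le_one p h0, hp ⟨0, h0⟩]
  simp

omit [NormedSpace ℝ E] [CompleteSpace E] in
/-- Values of the extended path are bounded by the sup norm: `‖p̃(t)‖ ≤ ‖p‖`. [folklore] -/
theorem norm_IccExtend_le (p : C(↥(Icc (0 : ℝ) 1), E)) (t : ℝ) :
    ‖IccExtend zero_le_one p t‖ ≤ ‖p‖ := by
  rw [IccExtend, Function.comp_apply]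
  exact ContinuousMap.norm_coe_le_norm p _

omit [NormedSpace ℝ E] [CompleteSpace E] in
/-- Values of two extended paths differ by at most the sup distance: `‖p̃(t) − q̃(t)‖ ≤ ‖p − q‖`.
[folklore] -/
theorem norm_IccExtend_sub_le (p q : C(↥(Icc (0 : ℝ) 1), E)) (t : ℝ) :
    ‖IccExtend zero_le_one p t - IccExtend zero_le_one q t‖ ≤ ‖p - q‖ := by
  simp only [IccExtend, Function.comp_apply]
  have := ContinuousMap.norm_coe_le_norm (p - q) (projIcc 0 1 zero_le_one t)
  simpa using this

end Picard

/-! ### Zeros of Newton–Kantorovich certificates under constant shifts -/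

section Shift

variable {X Y : Type*} [NormedAddCommGroup X] [NormedSpace ℝ X]
  [NormedAddCommGroup Y] [NormedSpace ℝ Y]

/-- **Lipschitz dependence of Newton–Kantorovich zeros on a constant shift of the map.** Let
`A : Y →L X`, `F : X → Y` with Fréchet derivative `F'(x)` and `‖I − A ∘ F'(x)‖ ≤ Z` at every point of the
closed ball `B̄_r(x̄)`, `Z < 1`. If `x₁, x₂ ∈ B̄_r(x̄)` with `F x₁ = 0` and `F x₂ + v = 0`, then
`‖x₁ − x₂‖ ≤ ‖A v‖ / (1 − Z)` (the Newton-like map `I − A F` is a `Z`-contraction on the ball by the mean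
value inequality, and it moves `x₂` exactly by `−A v`).
[cite: ConstantineauGarciaAzpeitiaLessard2021, Thm. 3.1 (arXiv p. 8), contraction step of the proof] -/
theorem norm_sub_le_of_zero_of_zero_add_const {F : X → Y} {F' : X → X →L[ℝ] Y} {xbar : X}
    {A : Y →L[ℝ] X} {Z r : ℝ} {v : Y} {x₁ x₂ : X}
    (hF : ∀ x ∈ closedBall xbar r, HasFDerivAt F (F' x) x)
    (hZ : ∀ x ∈ closedBall xbar r, ‖ContinuousLinearMap.id ℝ X - A.comp (F' x)‖ ≤ Z)
    (hZ1 : Z < 1) (hx₁ : x₁ ∈ closedBall xbar r) (hx₂ : x₂ ∈ closedBall xbar r)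
    (h₁ : F x₁ = 0) (h₂ : F x₂ + v = 0) :
    ‖x₁ - x₂‖ ≤ ‖A v‖ / (1 - Z) := by
  set g : X → X := newtonLikeMap A F with hg
  have hlip : ‖g x₁ - g x₂‖ ≤ Z * ‖x₁ - x₂‖ :=
    (convex_closedBall xbar r).norm_image_sub_le_of_norm_hasFDerivWithin_le
      (fun w hw => (hasFDerivAt_newtonLikeMap (hF w hw)).hasFDerivWithinAt) hZ hx₂ hx₁
  have hg₁ : g x₁ = x₁ := by simp [hg, newtonLikeMap_apply, h₁]
  have hFx₂ : F x₂ = -v := eq_neg_of_add_eq_zero_left h₂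
  have hg₂ : g x₂ = x₂ + A v := by
    simp [hg, newtonLikeMap_apply, hFx₂]
  rw [hg₁, hg₂] at hlip
  have hkey : ‖x₁ - x₂‖ ≤ Z * ‖x₁ - x₂‖ + ‖A v‖ := by
    have htri : ‖x₁ - x₂‖ ≤ ‖x₁ - (x₂ + A v)‖ + ‖A v‖ := by
      have := norm_add_le (x₁ - (x₂ + A v)) (A v)
      have e : x₁ - (x₂ + A v) + A v = x₁ - x₂ := by abel
      rwa [e] at this
    linarith
  rw [le_div_iff₀ (by linarith)]
  nlinarith

end Shift

end RadiiGlueR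

end Summit.NavierStokesRegularity.NavierStokesRegularity.Theorems

end
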